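/-
Copyright (c) 2026. All rights reserved.
Released under Apache 2.0 license as described in the file LICENSE.
Authors: abc-iut cell — seat abc-iut-w5-d225 (wave 5; §4(iii) non-vacuity programme, L4 rows
`Cuspidalization` / `BelyiCuspidalization` of abc-iut-w5-d243's INTERFACE-NV-CENSUS; L4-lead QUICK RULINGS #3z (2)).
-/
import Literature.AnabelianGeometry.AbsoluteAnabelian.AbsTopII.BelyiCuspidalization
import Mathlib.Topology.Instances.ZMod
import HarnessLib

/-!
# Non-vacuity of the [AbsTopII] Cor 3.7 output records `Cuspidalization` and `BelyiCuspidalization`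

S. Mochizuki, *Topics in absolute anabelian geometry II*, Cor 3.7 pp. 75–76 ("Belyi Cuspidalization").
abc-iut-L4-t1 typed the output of the group-theoretic algorithm as `AbsTopII.BelyiCuspidalization E` over an
abstract extension `E = (1 → Δ → Π → G → 1)` (14 fields, 7 axioms: normal open `Π_V`, the ranges of `Π_U ↠ Π_V`, the
glueing `Π_U = Π_V ×_Π Π_{U_X}`, uniqueness of topological outer liftings, centre-freeness of `Π_U`, …), on top of the
record `AbsTopII.Cuspidalization E` ("`Π_{U_X} ↠ Π` surjective over the same `G`").  abc-iut-w5-d243's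
INTERFACE-NV-CENSUS (03:03Z) lists `BelyiCuspidalization` with ZERO kernel inhabitants (5 consumer files).

PROOF-ONLY file (no `def`/`instance`/`structure`; witnesses inside the theorem terms), honest labels:
* `Cuspidalization.nonempty_self` — GENUINE and general: over EVERY extension `E` the identity `Π ↠ Π` is a
  cuspidalization (the case `U_X = X`: no point removed);
* `BelyiCuspidalization.exists_nonempty_degenerate` — DEGENERATE finite toy (`Π = G = ℤ/1`, `Π_V = Π`,
  `Π_U = Π_{U_X} = Π` with identity maps, parameters `(0,0,0)`, no cusps): the 7 axioms are JOINTLY SATISFIABLE.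
  What it certifies: no theorem over `BelyiCuspidalization E` is vacuous for want of ANY instance; what it does
  NOT: satisfiability at a genuine `Π_X` of a hyperbolic curve of strictly Belyi type (étale `π₁` not in Mathlib).
Nothing here bears on the disputed [IUTchIII] Cor. 3.12; consistency ≠ faithfulness; typed ≠ proved.
-/

namespace Literature.AnabelianGeometry.AbsoluteAnabelian.AbsTopII

open CategoryTheory Topology

universe u

/-- **The identity cuspidalization** (`U_X = X`): over every extension `E`, `Π ↠ Π` over `G = G` inhabits
`Cuspidalization E` (GENUINE, trivial case). [cite: MochizukiAbsTopII2013, Cor 3.7 p.75] -/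
theorem Cuspidalization.nonempty_self (E : FundamentalExtension.{u}) : Nonempty (Cuspidalization E) :=
  ⟨{ ext := E, hom := 𝟙 E, arith_surjective := Function.surjective_id, gal_bijective := Function.bijective_id }⟩

/-- **`BelyiCuspidalization` is jointly satisfiable (DEGENERATE finite toy)**: over the trivial extension
`Π = G = ℤ/1`, with `Π_V = Π`, `Π_U = Π_{U_X} = Π` (identity maps), chain parameters `(0,0,0)` and no cusps.
Honest label: degenerate — not a Belyi cuspidalization of a curve. [cite: MochizukiAbsTopII2013, Cor 3.7 pp.75-76] -/
theorem BelyiCuspidalization.exists_nonempty_degenerate :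
    ∃ E : FundamentalExtension.{0}, Subsingleton E.arith ∧ Nonempty (BelyiCuspidalization E) := by
  let T : Type := Multiplicative (ZMod 1)
  haveI hT : Subsingleton T := inferInstanceAs (Subsingleton (Multiplicative (Fin 1)))
  let E₁ : FundamentalExtension.{0} :=
    { arith := ProfiniteGrp.of T, gal := ProfiniteGrp.of T, aug := ContinuousMonoidHom.id T,
      aug_surjective := Function.surjective_id }
  haveI hE : Subsingleton E₁.arith := hT
  haveI hG : Subsingleton E₁.gal := hT
  refine ⟨E₁, hE, ⟨{
    PiV := ⊤
    normal_PiV := inferInstance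
    isOpen_PiV := isOpen_discrete _
    chainParams := (0, 0, 0)
    cuspU := E₁
    projU := 𝟙 E₁
    range_projU_arith := le_antisymm (fun _ _ => Subgroup.mem_top _) (fun x _ => ⟨1, Subsingleton.elim _ _⟩)
    range_projU_gal := le_antisymm (fun x _ => ⟨1, Subgroup.mem_top _, Subsingleton.elim _ _⟩)
      (fun x _ => ⟨1, Subsingleton.elim _ _⟩)
    cusp := { ext := E₁, hom := 𝟙 E₁, arith_surjective := Function.surjective_id,
              gal_bijective := Function.bijective_id }
    glue :=
      { toFun := fun _ => 1
        invFun := fun _ => 1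
        left_inv := fun x => Subtype.ext (Subsingleton.elim _ _)
        right_inv := fun x => Subsingleton.elim _ _
        map_mul' := fun _ _ => (mul_one _).symm }
    glue_comm := fun _ => Subsingleton.elim _ _
    lifting_unique := fun ρ ρ' _ _ _ _ => MonoidHom.ext fun g => by
      rw [Subsingleton.elim g 1, map_one, map_one]
    center_PiU_eq_bot := eq_bot_iff.2 fun x _ => Subgroup.mem_bot.2 (Subtype.ext (Subsingleton.elim _ _))
    cusps :=
      { Cusp := PEmpty.{1}
        Dcusp := fun x => x.elim
        Icusp := fun x => x.elim
        Icusp_eq := fun x => x.elim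
        isClosed_Dcusp := fun x => x.elim
        eq_of_conj := fun x => x.elim } }⟩⟩

end Literature.AnabelianGeometry.AbsoluteAnabelian.AbsTopII
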